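import Summits.QuantumFields.YangMills.Theorems.BalabanLadderNTCanonicalRiemannThree
import HarnessLib

/-!
# Crux `NT` (stmt-QuantumFields-19353), stub `stub_refpkgT : RefPkgT`: CANONICAL ENVELOPES V — the triple (E3) kernel term
# of the registered clause-5 margin is a Riemann sum

Helper file (`--supports stmt-QuantumFields-19353`) of the fleet lead prover of crux `NT` (unit `ym-spine-19353-p1`, GEN 12);
sequel of `…NTCanonicalRiemannThree` (triple Riemann sums, generic pair term).  Hypothesis-free; real analysis on the witness side.

* `one_div_pow_eight_sub_le` — `1/m⁸ − 1/(t+m)⁸ ≤ 8t/m⁹` (`m > 0`, `t ≥ 0`);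
* `tripleKernel_eq_max`, `continuous_tripleKernelMax`, `tsupport_tripleKernelMax_subset` — the `min`-distance kernel
  `|f(p₀)||g(p₁)||h(p₂)|/(t + min(‖p₁−p₀‖,‖p₂−p₁‖,‖p₂−p₀‖))⁸` of pairwise `δ'`-separated witnesses equals its `max(·, δ')`-regularisation,
  which is continuous with compact support;
* **`tripleTerm_tendsto_canonical`** — along any unit map `a > 0`, `a → 0` and boxes covering the support:
  `a⁴ Σ_{x,y,z} |f(a x)||g(a y)||h(a z)|/(1 + min(‖y−x‖,‖z−y‖,‖z−x‖))⁸ → ∫_{(ℝ⁴)³}|f(p₀)||g(p₁)||h(p₂)|/min(‖p₁−p₀‖,‖p₂−p₁‖,‖p₂−p₀‖)⁸`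
  (uniform kernel error `8a/δ'⁹` on charged triples + `tendsto_latticeSum₃`).

HONEST FRAMING.  Riemann sums and elementary kernel estimates; nothing about floors, ceilings, AF, NT, the seam or the gap; not
Clay.  Refs: GlimmJaffe1987 §6.1.
-/

set_option autoImplicit false

noncomputable section

open scoped SchwartzMap
open MeasureTheory Filter Topology
open Literature.MathematicalPhysics.QuantumFieldTheory Literature.MathematicalPhysics.QuantumLattice
open Literature.Probability.LatticeModels
open Summit.QuantumFields.YangMills.Cruxes.NT.Reference (norm_smul_siteToE_sub)

namespace Summit.QuantumFields.YangMills.Cruxes.NT.CeilingPrice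

/-! ## §3 The triple (E3) kernel term -/

section Triple

/-- `1/m⁸ − 1/(t+m)⁸ ≤ 8t/m⁹` for `m > 0`, `t ≥ 0`. [folklore] -/
theorem one_div_pow_eight_sub_le {m t : ℝ} (hm : 0 < m) (ht : 0 ≤ t) :
    1 / m ^ 8 - 1 / (t + m) ^ 8 ≤ 8 * t / m ^ 9 := by
  have htm : 0 < t + m := by linarith
  have hm0 : m ≠ 0 := hm.ne'
  have htm0 : t + m ≠ 0 := htm.ne'
  have e : 8 * t / m ^ 9 - (1 / m ^ 8 - 1 / (t + m) ^ 8) =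
      t ^ 2 * (36 * m ^ 7 + 168 * t * m ^ 6 + 378 * t ^ 2 * m ^ 5 + 504 * t ^ 3 * m ^ 4 + 420 * t ^ 4 * m ^ 3 +
        216 * t ^ 5 * m ^ 2 + 63 * t ^ 6 * m + 8 * t ^ 7) / (m ^ 9 * (t + m) ^ 8) := by
    field_simp
    ring
  have hnum : 0 ≤ t ^ 2 * (36 * m ^ 7 + 168 * t * m ^ 6 + 378 * t ^ 2 * m ^ 5 + 504 * t ^ 3 * m ^ 4 + 420 * t ^ 4 * m ^ 3 +
        216 * t ^ 5 * m ^ 2 + 63 * t ^ 6 * m + 8 * t ^ 7) / (m ^ 9 * (t + m) ^ 8) := by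
    positivity
  linarith

variable {f g h : 𝓢(EuclideanSpace ℝ (Fin 4), ℝ)} {δ' σ : ℝ}

/-- The `min`-distance kernel of the E3 term equals its `max(·, δ')`-regularisation on pairwise `δ'`-separated witnesses.
[folklore] -/
theorem tripleKernel_eq_max (hfg : ∀ p q : EuclideanSpace ℝ (Fin 4), f p ≠ 0 → g q ≠ 0 → δ' ≤ ‖p - q‖)
    (hgh : ∀ p q : EuclideanSpace ℝ (Fin 4), g p ≠ 0 → h q ≠ 0 → δ' ≤ ‖p - q‖)
    (hfh : ∀ p q : EuclideanSpace ℝ (Fin 4), f p ≠ 0 → h q ≠ 0 → δ' ≤ ‖p - q‖) (t : ℝ)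
    (p : Fin 3 → EuclideanSpace ℝ (Fin 4)) :
    |f (p 0)| * |g (p 1)| * |h (p 2)| / (t + min (min ‖p 1 - p 0‖ ‖p 2 - p 1‖) ‖p 2 - p 0‖) ^ 8 =
      |f (p 0)| * |g (p 1)| * |h (p 2)| / (t + max (min (min ‖p 1 - p 0‖ ‖p 2 - p 1‖) ‖p 2 - p 0‖) δ') ^ 8 := by
  by_cases h₀ : f (p 0) = 0
  · simp [h₀]
  by_cases h₁ : g (p 1) = 0
  · simp [h₁]
  by_cases h₂ : h (p 2) = 0
  · simp [h₂]
  have e1 := hfg _ _ h₀ h₁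
  have e2 := hgh _ _ h₁ h₂
  have e3 := hfh _ _ h₀ h₂
  rw [norm_sub_rev] at e1 e2 e3
  rw [max_eq_left (le_min (le_min e1 e2) e3)]

/-- The regularised triple kernel (`t = 0`) is continuous (`δ' > 0`). [folklore] -/
theorem continuous_tripleKernelMax (hδ' : 0 < δ') :
    Continuous fun p : Fin 3 → EuclideanSpace ℝ (Fin 4) =>
      |f (p 0)| * |g (p 1)| * |h (p 2)| / (0 + max (min (min ‖p 1 - p 0‖ ‖p 2 - p 1‖) ‖p 2 - p 0‖) δ') ^ 8 := by
  refine Continuous.div ?_ ?_ fun p => ?_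
  · exact ((((f.continuous.comp (continuous_apply 0)).abs).mul ((g.continuous.comp (continuous_apply 1)).abs)).mul
      ((h.continuous.comp (continuous_apply 2)).abs))
  · refine (continuous_const.add (Continuous.max ?_ continuous_const)).pow 8
    exact ((((continuous_apply 1).sub (continuous_apply 0)).norm).min
      (((continuous_apply 2).sub (continuous_apply 1)).norm)).min (((continuous_apply 2).sub (continuous_apply 0)).norm)
  · have : δ' ≤ 0 + max (min (min ‖p 1 - p 0‖ ‖p 2 - p 1‖) ‖p 2 - p 0‖) δ' := by
      rw [zero_add]; exact le_max_right _ _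
    exact (pow_pos (by linarith) 8).ne'

/-- The regularised triple kernel is supported in the pi-ball of radius `σ ≥ 0`. [folklore] -/
theorem tsupport_tripleKernelMax_subset (hσ : 0 ≤ σ)
    (hfσ : tsupport (f : EuclideanSpace ℝ (Fin 4) → ℝ) ⊆ Metric.closedBall 0 σ)
    (hgσ : tsupport (g : EuclideanSpace ℝ (Fin 4) → ℝ) ⊆ Metric.closedBall 0 σ)
    (hhσ : tsupport (h : EuclideanSpace ℝ (Fin 4) → ℝ) ⊆ Metric.closedBall 0 σ) (t : ℝ) :
    tsupport (fun p : Fin 3 → EuclideanSpace ℝ (Fin 4) =>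
      |f (p 0)| * |g (p 1)| * |h (p 2)| / (t + max (min (min ‖p 1 - p 0‖ ‖p 2 - p 1‖) ‖p 2 - p 0‖) δ') ^ 8) ⊆
      Metric.closedBall 0 σ := by
  refine closure_minimal (fun p hp => ?_) Metric.isClosed_closedBall
  have h₀ : f (p 0) ≠ 0 := fun e => hp (by simp [e])
  have h₁ : g (p 1) ≠ 0 := fun e => hp (by simp [e])
  have h₂ : h (p 2) ≠ 0 := fun e => hp (by simp [e])
  have hb₀ := hfσ (subset_tsupport _ (Function.mem_support.2 h₀))
  have hb₁ := hgσ (subset_tsupport _ (Function.mem_support.2 h₁))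
  have hb₂ := hhσ (subset_tsupport _ (Function.mem_support.2 h₂))
  rw [Metric.mem_closedBall, dist_zero_right] at hb₀ hb₁ hb₂ ⊢
  refine (pi_norm_le_iff_of_nonneg hσ).2 fun i => ?_
  fin_cases i
  · exact hb₀
  · exact hb₁
  · exact hb₂

/-- **The E3 kernel term is canonically `∫|f||g||h|/min(…)⁸`**: for pairwise `δ'`-separated witnesses `f, g, h` (`δ' > 0`) in the
ball of radius `σ ≥ 0`, along any unit map `a > 0`, `a → 0` and boxes covering the support,
`a⁴ Σ_{x,y,z} |f(a x)||g(a y)||h(a z)|/(1 + min(‖y−x‖,‖z−y‖,‖z−x‖))⁸ →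
∫_{(ℝ⁴)³}|f(p₀)||g(p₁)||h(p₂)|/min(‖p₁−p₀‖,‖p₂−p₁‖,‖p₂−p₀‖)⁸`. [cite: GlimmJaffe1987, §6.1] -/
theorem tripleTerm_tendsto_canonical (hδ' : 0 < δ') (hσ : 0 ≤ σ)
    (hfg : ∀ p q : EuclideanSpace ℝ (Fin 4), f p ≠ 0 → g q ≠ 0 → δ' ≤ ‖p - q‖)
    (hgh : ∀ p q : EuclideanSpace ℝ (Fin 4), g p ≠ 0 → h q ≠ 0 → δ' ≤ ‖p - q‖)
    (hfh : ∀ p q : EuclideanSpace ℝ (Fin 4), f p ≠ 0 → h q ≠ 0 → δ' ≤ ‖p - q‖)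
    (hfσ : tsupport (f : EuclideanSpace ℝ (Fin 4) → ℝ) ⊆ Metric.closedBall 0 σ)
    (hgσ : tsupport (g : EuclideanSpace ℝ (Fin 4) → ℝ) ⊆ Metric.closedBall 0 σ)
    (hhσ : tsupport (h : EuclideanSpace ℝ (Fin 4) → ℝ) ⊆ Metric.closedBall 0 σ) (a : ℝ → ℝ) (L : ℝ → ℕ)
    (ha : ∀ β, 0 < a β) (ha0 : Tendsto a atTop (𝓝 0)) (hL : ∀ᶠ β in atTop, σ ≤ a β * L β) :
    Tendsto (fun β => a β ^ 4 * ∑ x ∈ box 4 (L β), ∑ y ∈ box 4 (L β), ∑ z ∈ box 4 (L β),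
        |f (a β • siteToE x)| * |g (a β • siteToE y)| * |h (a β • siteToE z)| /
          (1 + min (min ‖siteToE (y - x)‖ ‖siteToE (z - y)‖) ‖siteToE (z - x)‖) ^ 8) atTop
      (𝓝 (∫ p : Fin 3 → EuclideanSpace ℝ (Fin 4), |f (p 0)| * |g (p 1)| * |h (p 2)| /
        min (min ‖p 1 - p 0‖ ‖p 2 - p 1‖) ‖p 2 - p 0‖ ^ 8)) := by
  set K : ℝ → (Fin 3 → EuclideanSpace ℝ (Fin 4)) → ℝ := fun t p =>
    |f (p 0)| * |g (p 1)| * |h (p 2)| / (t + max (min (min ‖p 1 - p 0‖ ‖p 2 - p 1‖) ‖p 2 - p 0‖) δ') ^ 8 with hK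
  -- (1) lattice term = a¹² ΣΣΣ K_a
  have hlat : ∀ β, a β ^ 4 * ∑ x ∈ box 4 (L β), ∑ y ∈ box 4 (L β), ∑ z ∈ box 4 (L β),
      |f (a β • siteToE x)| * |g (a β • siteToE y)| * |h (a β • siteToE z)| /
        (1 + min (min ‖siteToE (y - x)‖ ‖siteToE (z - y)‖) ‖siteToE (z - x)‖) ^ 8 =
      a β ^ 12 * ∑ x ∈ box 4 (L β), ∑ y ∈ box 4 (L β), ∑ z ∈ box 4 (L β),
        K (a β) (fun i => a β • siteToE (![x, y, z] i)) := by
    intro β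
    have hs := ha β
    rw [Finset.mul_sum, Finset.mul_sum]
    refine Finset.sum_congr rfl fun x _ => ?_
    rw [Finset.mul_sum, Finset.mul_sum]
    refine Finset.sum_congr rfl fun y _ => ?_
    rw [Finset.mul_sum, Finset.mul_sum]
    refine Finset.sum_congr rfl fun z _ => ?_
    have e1 : K (a β) (fun i => a β • siteToE (![x, y, z] i)) =
        |f (a β • siteToE x)| * |g (a β • siteToE y)| * |h (a β • siteToE z)| /
          (a β + min (min ‖a β • siteToE y - a β • siteToE x‖ ‖a β • siteToE z - a β • siteToE y‖)
            ‖a β • siteToE z - a β • siteToE x‖) ^ 8 := by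
      simp only [hK, Matrix.cons_val_zero, Matrix.cons_val_one, Matrix.cons_val]
      exact (tripleKernel_eq_max hfg hgh hfh (a β) ![a β • siteToE x, a β • siteToE y, a β • siteToE z]).symm
    rw [e1, norm_smul_siteToE_sub (a β) hs x y, norm_smul_siteToE_sub (a β) hs y z, norm_smul_siteToE_sub (a β) hs x z,
      ← mul_min_of_nonneg _ _ hs.le, ← mul_min_of_nonneg _ _ hs.le]
    have hden : 0 < 1 + min (min ‖siteToE (y - x)‖ ‖siteToE (z - y)‖) ‖siteToE (z - x)‖ := by
      have : 0 ≤ min (min ‖siteToE (y - x)‖ ‖siteToE (z - y)‖) ‖siteToE (z - x)‖ :=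
        le_min (le_min (norm_nonneg _) (norm_nonneg _)) (norm_nonneg _)
      linarith
    field_simp
  simp_rw [hlat]
  -- (2) Riemann limit of the regularised kernel
  have hmain : Tendsto (fun β => a β ^ 12 * ∑ x ∈ box 4 (L β), ∑ y ∈ box 4 (L β), ∑ z ∈ box 4 (L β),
      K 0 (fun i => a β • siteToE (![x, y, z] i))) atTop (𝓝 (∫ p, K 0 p)) :=
    tendsto_latticeSum₃ (g := K 0) (continuous_tripleKernelMax (f := f) (g := g) (h := h) hδ')
      (tsupport_tripleKernelMax_subset (δ' := δ') hσ hfσ hgσ hhσ 0) a L ha ha0 hL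
  have hint : ∫ p, K 0 p = ∫ p : Fin 3 → EuclideanSpace ℝ (Fin 4), |f (p 0)| * |g (p 1)| * |h (p 2)| /
      min (min ‖p 1 - p 0‖ ‖p 2 - p 1‖) ‖p 2 - p 0‖ ^ 8 := by
    refine integral_congr_ae (Eventually.of_forall fun p => ?_)
    have e := tripleKernel_eq_max hfg hgh hfh 0 p
    simp only [zero_add] at e
    simp only [hK, zero_add]
    exact e.symm
  rw [← hint]
  -- (3) the error term: `|K 0 − K a| ≤ (8a/δ'⁹)|f||g||h|`, summed `≤ (8a/δ'⁹)(a⁴S_f)(a⁴S_g)(a⁴S_h) → 0`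
  have herr : Tendsto (fun β => a β ^ 12 * ∑ x ∈ box 4 (L β), ∑ y ∈ box 4 (L β), ∑ z ∈ box 4 (L β),
      K 0 (fun i => a β • siteToE (![x, y, z] i)) -
      a β ^ 12 * ∑ x ∈ box 4 (L β), ∑ y ∈ box 4 (L β), ∑ z ∈ box 4 (L β),
        K (a β) (fun i => a β • siteToE (![x, y, z] i))) atTop (𝓝 0) := by
    have hf1 := tendsto_envelope f hfσ a L ha ha0 hL
    have hg1 := tendsto_envelope g hgσ a L ha ha0 hL
    have hh1 := tendsto_envelope h hhσ a L ha ha0 hL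
    have hbound : Tendsto (fun β => 8 * a β / δ' ^ 9 *
        ((a β ^ 4 * ∑ x ∈ box 4 (L β), |f (a β • siteToE x)|) *
          (a β ^ 4 * ∑ y ∈ box 4 (L β), |g (a β • siteToE y)|) *
          (a β ^ 4 * ∑ z ∈ box 4 (L β), |h (a β • siteToE z)|))) atTop (𝓝 0) := by
      have h1 : Tendsto (fun β => 8 * a β / δ' ^ 9) atTop (𝓝 (8 * 0 / δ' ^ 9)) := (ha0.const_mul 8).div_const _
      rw [mul_zero, zero_div] at h1
      simpa using h1.mul ((hf1.mul hg1).mul hh1)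
    refine squeeze_zero_norm' (Eventually.of_forall fun β => ?_) hbound
    have hs := ha β
    rw [Real.norm_eq_abs, ← mul_sub, ← Finset.sum_sub_distrib]
    simp_rw [← Finset.sum_sub_distrib]
    have hpt : ∀ x y z : Fin 4 → ℤ,
        |K 0 (fun i => a β • siteToE (![x, y, z] i)) - K (a β) (fun i => a β • siteToE (![x, y, z] i))| ≤
          8 * a β / δ' ^ 9 * (|f (a β • siteToE x)| * |g (a β • siteToE y)| * |h (a β • siteToE z)|) := by
      intro x y z
      simp only [hK, Matrix.cons_val_zero, Matrix.cons_val_one, Matrix.cons_val, zero_add]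
      set m := max (min (min ‖a β • siteToE y - a β • siteToE x‖ ‖a β • siteToE z - a β • siteToE y‖)
        ‖a β • siteToE z - a β • siteToE x‖) δ' with hm
      have hm2 : δ' ≤ m := le_max_right _ _
      have hm0 : 0 < m := by linarith
      set A := |f (a β • siteToE x)| * |g (a β • siteToE y)| * |h (a β • siteToE z)| with hA
      have hA0 : 0 ≤ A := by positivity
      rw [div_eq_mul_one_div A, div_eq_mul_one_div A (_ ^ 8), ← mul_sub]
      rw [abs_of_nonneg (mul_nonneg hA0 (by
        rw [sub_nonneg]
        exact one_div_le_one_div_of_le (pow_pos hm0 8) (pow_le_pow_left₀ hm0.le (by linarith) 8)))]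
      rw [mul_comm (8 * a β / δ' ^ 9) A]
      refine mul_le_mul_of_nonneg_left ?_ hA0
      calc 1 / m ^ 8 - 1 / (a β + m) ^ 8 ≤ 8 * a β / m ^ 9 := one_div_pow_eight_sub_le hm0 hs.le
        _ ≤ 8 * a β / δ' ^ 9 :=
            div_le_div_of_nonneg_left (by linarith) (pow_pos hδ' 9) (pow_le_pow_left₀ hδ'.le hm2 9)
    calc |a β ^ 12 * ∑ x ∈ box 4 (L β), ∑ y ∈ box 4 (L β), ∑ z ∈ box 4 (L β),
          (K 0 (fun i => a β • siteToE (![x, y, z] i)) - K (a β) (fun i => a β • siteToE (![x, y, z] i)))|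
        = a β ^ 12 * |∑ x ∈ box 4 (L β), ∑ y ∈ box 4 (L β), ∑ z ∈ box 4 (L β),
          (K 0 (fun i => a β • siteToE (![x, y, z] i)) - K (a β) (fun i => a β • siteToE (![x, y, z] i)))| := by
          rw [abs_mul, abs_of_pos (pow_pos hs 12)]
      _ ≤ a β ^ 12 * ∑ x ∈ box 4 (L β), ∑ y ∈ box 4 (L β), ∑ z ∈ box 4 (L β),
          8 * a β / δ' ^ 9 * (|f (a β • siteToE x)| * |g (a β • siteToE y)| * |h (a β • siteToE z)|) := by
          refine mul_le_mul_of_nonneg_left ?_ (pow_nonneg hs.le 12)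
          refine (Finset.abs_sum_le_sum_abs _ _).trans (Finset.sum_le_sum fun x _ => ?_)
          refine (Finset.abs_sum_le_sum_abs _ _).trans (Finset.sum_le_sum fun y _ => ?_)
          exact (Finset.abs_sum_le_sum_abs _ _).trans (Finset.sum_le_sum fun z _ => hpt x y z)
      _ = 8 * a β / δ' ^ 9 * ((a β ^ 4 * ∑ x ∈ box 4 (L β), |f (a β • siteToE x)|) *
          (a β ^ 4 * ∑ y ∈ box 4 (L β), |g (a β • siteToE y)|) *
          (a β ^ 4 * ∑ z ∈ box 4 (L β), |h (a β • siteToE z)|)) := by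
          have e : ∑ x ∈ box 4 (L β), ∑ y ∈ box 4 (L β), ∑ z ∈ box 4 (L β),
              8 * a β / δ' ^ 9 * (|f (a β • siteToE x)| * |g (a β • siteToE y)| * |h (a β • siteToE z)|) =
              8 * a β / δ' ^ 9 * ((∑ x ∈ box 4 (L β), |f (a β • siteToE x)|) *
                (∑ y ∈ box 4 (L β), |g (a β • siteToE y)|) * (∑ z ∈ box 4 (L β), |h (a β • siteToE z)|)) := by
            rw [Finset.sum_mul_sum, Finset.sum_mul, Finset.mul_sum]
            refine Finset.sum_congr rfl fun x _ => ?_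
            rw [Finset.sum_mul, Finset.mul_sum]
            refine Finset.sum_congr rfl fun y _ => ?_
            rw [Finset.mul_sum, Finset.mul_sum]
          rw [e]
          ring
  have := hmain.sub herr
  simp only [sub_sub_cancel, sub_zero] at this
  exact this

end Triple

end Summit.QuantumFields.YangMills.Cruxes.NT.CeilingPrice

end
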